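import Summits.Ventures.PercRepro0.Events

/-! # F2 in Lean: translation invariance of the percolation measure (p5)

ROUTE-v3/v4 F2 (FOUNDATIONS-p5 Theorem F2) for the translations of `ℤ^d`, formalised on `Defs.lean`:

* `relabel g ω = g ⁻¹' ω` relabels a configuration along a bijection `g` of the index type; it is measurable, and
  `setBer(u, p)` is invariant under it whenever `g` preserves `u` (`setBernoulli_map_relabel`, via Mathlib's
  `Measure.infinitePi_map_piCongrLeft`);
* for the lattice: `bondShift z` is the bijection `e ↦ e + z` of the bonds, `shiftConfig z ω = { e : e + z ∈ ω }` the
  translated configuration, and `P_map_shiftConfig : (P d p).map (shiftConfig z) = P d p` (F2(a));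
* `openGraphShiftIso`: translation is a graph isomorphism `openGraph (shiftConfig z ω) ≃g openGraph ω`, hence
  `conn_shiftConfig`, `connInf_shiftConfig` (F2(b));
* consequences (F2(c)): `P_connInf_eq_thetaI` (`θ_x = θ_d` for every vertex `x`), `tau_add` and `tau_eq_tau_zero_sub`
  (`τ_p(x+z, y+z) = τ_p(x, y)`, `τ_p(x, y) = τ_p(0, y − x)`).
-/

namespace Summit.Ventures.PercRepro0.Defs

open MeasureTheory ProbabilityTheory unitInterval Set
open scoped ENNReal

section Relabel

variable {ι : Type*}

/-- Relabelling a configuration along a bijection of the index type: `e ∈ relabel g ω ↔ g e ∈ ω`. -/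
def relabel (g : ι ≃ ι) (ω : Set ι) : Set ι := g ⁻¹' ω

/-- Membership in a relabelled configuration. -/
theorem mem_relabel (g : ι ≃ ι) (ω : Set ι) (e : ι) : e ∈ relabel g ω ↔ g e ∈ ω := Iff.rfl

/-- Relabelling is measurable. -/
theorem measurable_relabel (g : ι ≃ ι) : Measurable (relabel g) := by
  rw [measurable_set_iff]
  intro a
  exact measurable_set_mem (g a)

/-- The reindexing measurable equivalence on `ι → Prop` along `g.symm` acts by precomposition with `g`. -/
theorem piCongrLeft_symm_apply_eq (g : ι ≃ ι) (P : ι → Prop) :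
    (MeasurableEquiv.piCongrLeft (fun _ : ι => Prop) g.symm) P = P ∘ g := by
  funext a
  have h := MeasurableEquiv.piCongrLeft_apply_apply g.symm (β := fun _ : ι => Prop) P (g a)
  simpa using h

/-- `setBer(u, p)` is invariant under relabelling along a bijection preserving `u`. -/
theorem setBernoulli_map_relabel (u : Set ι) (p : I) (g : ι ≃ ι) (hu : ∀ i, g i ∈ u ↔ i ∈ u) :
    (setBernoulli u p).map (relabel g) = setBernoulli u p := by
  have hμ : (fun i : ι => toNNReal p • Measure.dirac (g.symm i ∈ u) + toNNReal (σ p) • Measure.dirac False)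
      = fun i : ι => toNNReal p • Measure.dirac (i ∈ u) + toNNReal (σ p) • Measure.dirac False := by
    funext i
    have : (g.symm i ∈ u) = (i ∈ u) := propext (by rw [← hu (g.symm i), g.apply_symm_apply])
    rw [this]
  have hcomp : relabel g ∘ (fun P : ι → Prop => {i | P i}) =
      (fun P : ι → Prop => {i | P i}) ∘ (MeasurableEquiv.piCongrLeft (fun _ : ι => Prop) g.symm) := by
    funext P
    rw [Function.comp_apply, Function.comp_apply, piCongrLeft_symm_apply_eq]
    rfl
  rw [setBernoulli_eq_map, Measure.map_map (measurable_relabel g) measurable_setOf, hcomp,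
    ← Measure.map_map measurable_setOf (MeasurableEquiv.measurable _)]
  congr 1
  have h := Measure.infinitePi_map_piCongrLeft
    (fun i : ι => toNNReal p • Measure.dirac (i ∈ u) + toNNReal (σ p) • Measure.dirac False) g.symm
  rw [hμ] at h
  exact h

end Relabel

variable {d : ℕ}

/-- The translation `e ↦ e + z` of the bonds, as a bijection of `Sym2 (Vertex d)`. -/
def bondShift (z : Vertex d) : Sym2 (Vertex d) ≃ Sym2 (Vertex d) where
  toFun := Sym2.map (· + z)
  invFun := Sym2.map (· - z)
  left_inv := fun e => by simp [Sym2.map_map]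
  right_inv := fun e => by simp [Sym2.map_map]

/-- `bondShift` on a pair. -/
theorem bondShift_pair (z x y : Vertex d) : bondShift z s(x, y) = s(x + z, y + z) := by
  simp [bondShift]

/-- Translations preserve the bond set. -/
theorem bondShift_mem_bonds (z : Vertex d) (e : Sym2 (Vertex d)) :
    bondShift z e ∈ bonds d ↔ e ∈ bonds d := by
  induction e using Sym2.ind with
  | h x y =>
    rw [bondShift_pair]
    show s(x + z, y + z) ∈ (lattice d).edgeSet ↔ s(x, y) ∈ (lattice d).edgeSet
    rw [SimpleGraph.mem_edgeSet, SimpleGraph.mem_edgeSet]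
    show (∑ i, |(x + z) i - (y + z) i|) = 1 ↔ (∑ i, |x i - y i|) = 1
    simp only [Pi.add_apply, add_sub_add_right_eq_sub]

/-- The translated configuration: `e ∈ shiftConfig z ω ↔ e + z ∈ ω`. -/
def shiftConfig (z : Vertex d) (ω : Config d) : Config d := relabel (bondShift z) ω

/-- Translating configurations is measurable. -/
theorem measurable_shiftConfig (z : Vertex d) : Measurable (shiftConfig z) :=
  measurable_relabel _

/-- F2(a): `P_p` is invariant under translations. -/
theorem P_map_shiftConfig (z : Vertex d) (p : I) : (P d p).map (shiftConfig z) = P d p :=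
  setBernoulli_map_relabel (bonds d) p (bondShift z) (bondShift_mem_bonds z)

/-- F2(a), event form: `P_p(T_z^{-1} A) = P_p(A)` for measurable `A`. -/
theorem P_shiftConfig_preimage (z : Vertex d) (p : I) {A : Set (Config d)} (hA : MeasurableSet A) :
    P d p (shiftConfig z ⁻¹' A) = P d p A := by
  rw [← Measure.map_apply (measurable_shiftConfig z) hA, P_map_shiftConfig]

/-- Adjacency in the open graph of a translated configuration. -/
theorem openGraph_shiftConfig_adj (z : Vertex d) (ω : Config d) (x y : Vertex d) :
    (openGraph d (shiftConfig z ω)).Adj x y ↔ (openGraph d ω).Adj (x + z) (y + z) := by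
  rw [openGraph, openGraph, SimpleGraph.fromEdgeSet_adj, SimpleGraph.fromEdgeSet_adj,
    Set.mem_inter_iff, Set.mem_inter_iff]
  have h1 : s(x, y) ∈ shiftConfig z ω ↔ s(x + z, y + z) ∈ ω := by
    show bondShift z s(x, y) ∈ ω ↔ _
    rw [bondShift_pair]
  have h2 : s(x, y) ∈ bonds d ↔ s(x + z, y + z) ∈ bonds d := by
    have h := (bondShift_mem_bonds z s(x, y)).symm
    rw [bondShift_pair] at h
    exact h
  have h3 : x ≠ y ↔ x + z ≠ y + z := by simp
  rw [h1, h2, h3]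

/-- F2(b): translation is an isomorphism between the open graphs of `shiftConfig z ω` and `ω`. -/
def openGraphShiftIso (z : Vertex d) (ω : Config d) :
    openGraph d (shiftConfig z ω) ≃g openGraph d ω where
  toEquiv := Equiv.addRight z
  map_rel_iff' := fun {x y} => (openGraph_shiftConfig_adj z ω x y).symm

/-- F2(b): connections are transported by translations. -/
theorem conn_shiftConfig (z : Vertex d) (ω : Config d) (x y : Vertex d) :
    Conn d (shiftConfig z ω) x y ↔ Conn d ω (x + z) (y + z) :=
  (SimpleGraph.Iso.reachable_iff (φ := openGraphShiftIso z ω)).symm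

/-- F2(b): clusters are transported by translations. -/
theorem cluster_shiftConfig (z : Vertex d) (ω : Config d) (x : Vertex d) :
    cluster d (shiftConfig z ω) x = (· + z) ⁻¹' cluster d ω (x + z) := by
  ext y
  exact conn_shiftConfig z ω x y

/-- F2(b): `x ↔ ∞` is transported by translations. -/
theorem connInf_shiftConfig (z : Vertex d) (ω : Config d) (x : Vertex d) :
    ConnInf d (shiftConfig z ω) x ↔ ConnInf d ω (x + z) := by
  unfold ConnInf
  rw [cluster_shiftConfig]
  constructor
  · intro h
    exact ((Set.infinite_image_iff (add_left_injective z).injOn).2 h).mono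
      (Set.image_preimage_subset _ _)
  · intro h
    exact h.preimage fun y _ => ⟨y - z, sub_add_cancel y z⟩

/-- `{x ↔ ∞}` is the translate of `{0 ↔ ∞}`. -/
theorem preimage_shiftConfig_percolates (z : Vertex d) :
    shiftConfig z ⁻¹' percolates d = {ω : Config d | ConnInf d ω z} := by
  ext ω
  show ConnInf d (shiftConfig z ω) 0 ↔ ConnInf d ω z
  rw [connInf_shiftConfig, zero_add]

/-- F2(c): `θ_x(p) = θ_d(p)` for every vertex `x`. -/
theorem P_connInf_eq_thetaI (p : I) (x : Vertex d) :
    (P d p {ω : Config d | ConnInf d ω x}).toReal = thetaI d p := by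
  rw [← preimage_shiftConfig_percolates x, P_shiftConfig_preimage x p measurableSet_percolates]
  rfl

/-- `{x + z ↔ y + z}` is the translate of `{x ↔ y}`. -/
theorem preimage_shiftConfig_conn (z x y : Vertex d) :
    shiftConfig z ⁻¹' {ω : Config d | Conn d ω x y} = {ω : Config d | Conn d ω (x + z) (y + z)} := by
  ext ω
  exact conn_shiftConfig z ω x y

/-- F2(c): translation invariance of the two-point function. -/
theorem tau_add (p : I) (x y z : Vertex d) : tau d p (x + z) (y + z) = tau d p x y := by
  unfold tau
  rw [← preimage_shiftConfig_conn z x y, P_shiftConfig_preimage z p (measurableSet_conn x y)]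

/-- F2(c): `τ_p(x, y) = τ_p(0, y − x)`. -/
theorem tau_eq_tau_zero_sub (p : I) (x y : Vertex d) : tau d p x y = tau d p 0 (y - x) := by
  have h := tau_add p 0 (y - x) x
  rw [zero_add, sub_add_cancel] at h
  exact h

end Summit.Ventures.PercRepro0.Defs
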